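import Mathlib.Tactic.IntervalCases
import Summits.ValiantsHypothesis.ValiantsHypothesis.Theorems.KPlusLogSqLawTropicalBSeparatedTowerRobust

/-!
# Route «KPlusLogSqLaw», crux `TropicalB` (stmt-ValiantsHypothesis-19771) — THE SEPARATED SECTOR SATISFIES THE INEQUALITY OF
# `TropicalB` WITH `C = 4`, FOR EVERY CHAIN AT EVERY SLOPE

HONEST FRAMING.  Helper toward the registered stubs `stub_tropThin` / `stub_tropFat` of `Cruxes/TropicalB/Lines/birth.lean`
(crux `Summit.ValiantsHypothesis.ValiantsHypothesis.Theses.KPlusLogSqLaw.TropicalB`, item stmt-ValiantsHypothesis-19771, route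
KPlusLogSqLaw; cell `pub-symmetroid`, seat val-sym-trop-p1 g8, 2026-08-27; `--supports … --as helper`).  A SECTOR theorem: it proves the
conclusion of `TropicalB` (`n ≤ 2 ^ (C * (K + Nat.log 2 m ^ 2))`, here with `C = 4`) under the crux's own hypotheses on the chain
(`StrictMono θ`, every term dominant, consecutive signs alternate) ONLY for designs of the separated half-exponent sector (and its
`B`-neighbourhood); nothing here bounds `TropicalB` for general designs or bears on `WeakLifting`, DoorA26 / DoorA34, `MatrixDescartes`
or VP ≠ VNP.

CONTENTS.  `tower_le_two_pow` (`K·m·5^K + 2 ≤ 2^(4(K + log₂² m))` for `K ≥ 1`), `ne_of_termSign_mul_neg` (alternating signs force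
distinct consecutive terms), `tropicalB_shape_of_sector` (from `chain_le_tower_doubled`, …SeparatedTowerAll) and
`tropicalB_shape_of_sector_robust` (from `chain_le_tower_doubled_robust`, …SeparatedTowerRobust).
-/

set_option linter.dupNamespace false
set_option autoImplicit false

namespace Summit.ValiantsHypothesis.ValiantsHypothesis.Theorems.KPlusLogSqLaw

namespace SeparatedLex

open Summit.ValiantsHypothesis.ValiantsHypothesis.Theorems.MatrixDescartes.Negative
open Finset
open scoped BigOperators
open Literature.Computability.MetaComplexity.PBij

variable {m K : ℕ}

/-- the tower bound is below the `TropicalB` budget with `C = 4`: `K·m·5^K + 2 ≤ 2^(4(K + log₂² m))` for `K ≥ 1`. [folklore] -/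
theorem tower_le_two_pow (hK : 0 < K) : K * m * 5 ^ K + 2 ≤ 2 ^ (4 * (K + Nat.log 2 m ^ 2)) := by
  have key : ∀ k : ℕ, 0 < k → k * 5 ^ k + 2 ≤ 16 ^ k := by
    intro k hk
    induction k with
    | zero => omega
    | succ k ih =>
      rcases Nat.eq_zero_or_pos k with rfl | hk'
      · norm_num
      · have h1 := ih hk'
        have h5 : 0 < 5 ^ k := pow_pos (by norm_num) k
        rw [pow_succ, pow_succ]
        nlinarith
  have hm : m ≤ 2 ^ (4 * Nat.log 2 m ^ 2) := by
    rcases Nat.lt_or_ge m 2 with h | h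
    · interval_cases m <;> simp
    · have hL : 0 < Nat.log 2 m := Nat.log_pos (by norm_num) h
      have hlt : m < 2 ^ (Nat.log 2 m + 1) := Nat.lt_pow_succ_log_self (by norm_num) m
      have hexp : Nat.log 2 m + 1 ≤ 4 * Nat.log 2 m ^ 2 := by nlinarith
      exact hlt.le.trans (Nat.pow_le_pow_right (by norm_num) hexp)
  have hk := key K hK
  have e : 2 ^ (4 * (K + Nat.log 2 m ^ 2)) = 16 ^ K * 2 ^ (4 * Nat.log 2 m ^ 2) := by
    rw [Nat.mul_add, pow_add, pow_mul]; norm_num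
  rw [e]
  rcases Nat.eq_zero_or_pos m with rfl | hm1
  · have h1 : 1 ≤ 2 ^ (4 * Nat.log 2 0 ^ 2) := Nat.one_le_two_pow
    calc K * 0 * 5 ^ K + 2 ≤ 16 ^ K := by omega
      _ = 16 ^ K * 1 := (Nat.mul_one _).symm
      _ ≤ 16 ^ K * 2 ^ (4 * Nat.log 2 0 ^ 2) := Nat.mul_le_mul_left _ h1
  · calc K * m * 5 ^ K + 2 ≤ m * (K * 5 ^ K + 2) := by nlinarith
      _ ≤ m * 16 ^ K := Nat.mul_le_mul_left _ hk
      _ ≤ 2 ^ (4 * Nat.log 2 m ^ 2) * 16 ^ K := Nat.mul_le_mul_right _ hm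
      _ = 16 ^ K * 2 ^ (4 * Nat.log 2 m ^ 2) := Nat.mul_comm _ _

/-- alternating signs force distinct consecutive terms. [folklore] -/
theorem ne_of_termSign_mul_neg (ε : Fin m → Fin m → Fin K → ℤ) {p p' : Equiv.Perm (Fin m) × (Fin m → Fin K)}
    (h : termSign ε p * termSign ε p' < 0) : p ≠ p' := by
  rintro rfl
  exact absurd h (not_lt.2 (mul_self_nonneg _))

/-- **THE SEPARATED HALF-EXPONENT SECTOR SATISFIES `TropicalB`'S INEQUALITY WITH `C = 4`.**  For a design of the sector of
`chain_le_tower_doubled` (…SeparatedTowerAll: even exponents `2·d j`, `d` strictly increasing and super-separated with `d z = 0`,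
valuations `d j · u` with odd digits `|u| ≤ A` off the bottom class, `|v a b z| ≤ A`, dense bottom and top classes, generic digits per
class), every chain as in the crux — strictly increasing integer slopes, every term dominant, consecutive signs alternating — has
`n ≤ 2 ^ (4 * (K + Nat.log 2 m ^ 2))`. -/
theorem tropicalB_shape_of_sector (d : Fin K → ℕ) (v ε : Fin m → Fin m → Fin K → ℤ) (u : Fin m → Fin m → Fin K → ℤ)
    (A : ℕ) (z t : Fin K) (htz : t ≠ z) (hdz : d z = 0) (hmono : StrictMono d) (htop : ∀ j, d j ≤ d t)
    (hu : ∀ a b j, j ≠ z → v a b j = (d j : ℤ) * u a b j) (huA : ∀ a b j, |u a b j| ≤ A) (hvz : ∀ a b, |v a b z| ≤ A)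
    (hdense : ∀ a b, ε a b z ≠ 0) (hdenset : ∀ a b, ε a b t ≠ 0)
    (hsep : ∀ j j', d j < d j' → 8 * m ^ 2 * (A + 1) * d j ≤ d j') (hsep0 : ∀ j, j ≠ z → 8 * m ^ 2 * (A + 1) ≤ d j)
    (hodd : ∀ a b j, j ≠ z → ε a b j ≠ 0 → Odd (u a b j))
    (hgen : ∀ j, j ≠ z → ∀ X Y : Finset (Fin m × Fin m), IsPMatching X → IsPMatching Y → (∀ e ∈ X, ε e.1 e.2 j ≠ 0) →
      (∀ e ∈ Y, ε e.1 e.2 j ≠ 0) → X.card = Y.card → ∑ e ∈ X, u e.1 e.2 j = ∑ e ∈ Y, u e.1 e.2 j → X = Y)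
    {n : ℕ} (θ : Fin (n + 1) → ℤ) (p : Fin (n + 1) → Equiv.Perm (Fin m) × (Fin m → Fin K))
    (hθ : StrictMono θ) (hdom : ∀ k, IsDominant (fun j => 2 * d j) v ε (θ k) (p k))
    (halt : ∀ k : Fin n, termSign ε (p k.castSucc) * termSign ε (p k.succ) < 0) :
    n ≤ 2 ^ (4 * (K + Nat.log 2 m ^ 2)) :=
  (chain_le_tower_doubled d v ε u A z t htz hdz hmono htop hu huA hvz hdense hdenset hsep hsep0 hodd hgen θ p hθ hdom
    (fun k => ne_of_termSign_mul_neg ε (halt k))).trans (tower_le_two_pow (Fin.pos z))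

/-- **THE SAME ON THE `B`-NEIGHBOURHOOD OF THE SECTOR.**  As `tropicalB_shape_of_sector` for valuations within `B` of the half-exponent
lattice (`|v a b j − d j · u a b j| ≤ B`, `u` odd), separation constant `8m²(A+B+1)` (from `chain_le_tower_doubled_robust`,
…SeparatedTowerRobust). -/
theorem tropicalB_shape_of_sector_robust (d : Fin K → ℕ) (v ε : Fin m → Fin m → Fin K → ℤ) (u : Fin m → Fin m → Fin K → ℤ)
    (A B : ℕ) (z t : Fin K) (htz : t ≠ z) (hdz : d z = 0) (hmono : StrictMono d) (htop : ∀ j, d j ≤ d t)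
    (huR : ∀ a b j, j ≠ z → |v a b j - (d j : ℤ) * u a b j| ≤ B) (huA : ∀ a b j, |u a b j| ≤ A) (hvz : ∀ a b, |v a b z| ≤ A)
    (hdense : ∀ a b, ε a b z ≠ 0) (hdenset : ∀ a b, ε a b t ≠ 0)
    (hsep : ∀ j j', d j < d j' → 8 * m ^ 2 * (A + B + 1) * d j ≤ d j') (hsep0 : ∀ j, j ≠ z → 8 * m ^ 2 * (A + B + 1) ≤ d j)
    (hodd : ∀ a b j, j ≠ z → ε a b j ≠ 0 → Odd (u a b j))
    (hgen : ∀ j, j ≠ z → ∀ X Y : Finset (Fin m × Fin m), IsPMatching X → IsPMatching Y → (∀ e ∈ X, ε e.1 e.2 j ≠ 0) →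
      (∀ e ∈ Y, ε e.1 e.2 j ≠ 0) → X.card = Y.card → ∑ e ∈ X, u e.1 e.2 j = ∑ e ∈ Y, u e.1 e.2 j → X = Y)
    {n : ℕ} (θ : Fin (n + 1) → ℤ) (p : Fin (n + 1) → Equiv.Perm (Fin m) × (Fin m → Fin K))
    (hθ : StrictMono θ) (hdom : ∀ k, IsDominant (fun j => 2 * d j) v ε (θ k) (p k))
    (halt : ∀ k : Fin n, termSign ε (p k.castSucc) * termSign ε (p k.succ) < 0) :
    n ≤ 2 ^ (4 * (K + Nat.log 2 m ^ 2)) :=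
  (chain_le_tower_doubled_robust d v ε u A B z t htz hdz hmono htop huR huA hvz hdense hdenset hsep hsep0 hodd hgen θ p hθ hdom
    (fun k => ne_of_termSign_mul_neg ε (halt k))).trans (tower_le_two_pow (Fin.pos z))

end SeparatedLex

end Summit.ValiantsHypothesis.ValiantsHypothesis.Theorems.KPlusLogSqLaw
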